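import Summits.AtomisticToContinuum.BoseEinsteinCondensation.Theses.BECDispersionLadder
import Summits.AtomisticToContinuum.BoseEinsteinCondensation.Theorems.BECDispersionLadderEndpointTransferEnergyContinuity
import Summits.AtomisticToContinuum.BoseEinsteinCondensation.Theorems.BECConjugateDominationHardCoreExtensionBoundedPositiveMinimiser
import Literature.MathematicalPhysics.QuantumManyBody.PeriodicFeynmanKacCompact
import HarnessLib

/-!
# Route `BECDispersionLadder`, support item `EndpointTransfer` (stmt-AtomisticToContinuum-14557), III:
# the endpoint transfer from the maximal-form bound; unconditional for integrable interactions

`EndpointTransfer` (rung 3 of the route, fixed volume): if for every `α` in a window `(α₀, 2)` all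
`δ`-near-minimisers of the fractional energy `E_α` on the torus of side `L` have constant-mode occupation `≥ cN`,
then for some `δ' > 0` all `δ'`-near-minimisers of the ordinary `periodicEnergy` do (same `c`).

Mechanism, as filed: (H1) the dial comparison `E_α[Ψ] ≤ E_2[Ψ] + (2-α)N` for `1 ≤ α ≤ 2`
(`fracPeriodicEnergy_le_periodicEnergy_add`: `t^α ≤ t² + (2-α)` and `∑_p n_Ψ(p) = N`), and (H2) energy continuity
`∀ ε > 0 ∀ α₁ < 2 ∃ α ∈ [α₁,2): E^per ≤ E_α + ε`; then a `δ/3`-near-minimiser of `E_2 = periodicEnergy` is a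
`δ`-near-minimiser of `E_α` for a suitable `α` in the window (`endpointTransfer_of_energyContinuity`).

(H2) at `(v, N, L)` is proved here FROM THE MAXIMAL-FORM BOUND at `(v, N, L)` — the statement that the periodic `C¹`
Bose core realises the infimum of the maximal form `Q_v(η) = ∑_ν (2πν/L)²|⟪e_ν,η⟫|² + ∫ (W∘fromUnitTorusN)|η|²` over unit
Bose-symmetric `η ∈ L²((ℝ/ℤ)^{3N})` (`energyContinuity_of_maxFormBound`): by the tree's compactness half
(`…UvThomsonForceWave.exists_limitProfile`) it gives `E^per(v) ≤ supₙ E^per(min(v,n))`, part II gives energy continuity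
for each bounded truncation `min(v,n)`, and `E_α(min(v,n)) ≤ E_α(v)`. Consequences:

* `endpointTransfer_of_maxFormBound` — `MaxFormBound → EndpointTransfer`, with `MaxFormBound` VERBATIM the hypothesis
  `hcore` of `…UvThomsonForceWave.truncationLimit_of_maxFormBound` (the registered, unproved stub `stub_maxFormBound` of
  stmt-AtomisticToContinuum-12057; also GaussianDominationCan D2a, HardCoreExtension S7a): the item is a theorem modulo
  that one classical fact (Kato–Simon form core of the hard-core pair form; needs capacity / ACL tools absent from Mathlib);
* `endpointTransfer_of_integrable` — the conclusion of `EndpointTransfer` UNCONDITIONALLY for every admissible `v` with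
  `∫_{[0,L)^{3N}} W < ∞` (e.g. bounded `v`, `endpointTransfer_of_bounded`), where the maximal-form bound is the tree's
  `BoseGas.periodicGroundStateEnergy_le_maxForm` (Simon's theorem in the Bose sector).

References: B. Simon, *J. Operator Theory* 1 (1979) 37–47; [ReedSimonIV1978] Thm XIII.64; [LSSY2005] App. A.
-/

noncomputable section

open MeasureTheory Filter UnitAddTorus Complex
open scoped ENNReal NNReal BigOperators Topology InnerProductSpace ComplexConjugate

namespace Summit.AtomisticToContinuum.BoseEinsteinCondensation.Theorems

open Literature.MathematicalPhysics.QuantumManyBody.BoseGas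
open Summit.AtomisticToContinuum.BoseEinsteinCondensation.Cruxes.StaticResponseBound.UvThomsonForceWave

-- The measure on `ℝ/ℤ` is the Haar PROBABILITY measure, as in `PeriodicFormDomain.lean`.
attribute [local instance] Literature.MathematicalPhysics.QuantumManyBody.BoseGas.formDomain_measureSpace
  Literature.MathematicalPhysics.QuantumManyBody.BoseGas.formDomain_isProbabilityMeasure
  Literature.MathematicalPhysics.QuantumManyBody.BoseGas.formDomain_isProbabilityMeasure_pi

namespace EndpointTransfer

variable {N : ℕ} {L : ℝ}

/-! ### (H1) The dial comparison `E_α ≤ E_2 + (2 - α) N` -/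

/-- `t^α ≤ t² + (2 - α)` for `t ≥ 0` and `1 ≤ α ≤ 2` (for `t ≥ 1`, `t^α ≤ t²`; for `t ≤ 1`,
`t^α - t² = t^α(1 - t^{2-α}) ≤ t^α (2-α)(-log t) ≤ (2-α) t(1/t - 1) ≤ 2 - α`). [folklore] -/
theorem rpow_le_rpow_two_add {t α : ℝ} (ht : 0 ≤ t) (hα1 : 1 ≤ α) (hα2 : α ≤ 2) :
    t ^ α ≤ t ^ (2 : ℝ) + (2 - α) := by
  rcases eq_or_lt_of_le ht with h0 | htpos
  · rw [← h0, Real.zero_rpow (by linarith), Real.zero_rpow two_ne_zero]; linarith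
  rcases le_total 1 t with h1 | h1
  · have h := Real.rpow_le_rpow_of_exponent_le h1 hα2; linarith
  · have hlog : 1 - t ^ (2 - α) ≤ -((2 - α) * Real.log t) := by
      have h := Real.add_one_le_exp ((2 - α) * Real.log t)
      rw [mul_comm, ← Real.rpow_def_of_pos htpos] at h
      linarith
    have hneglog : -Real.log t ≤ t⁻¹ - 1 := by
      have h := Real.log_le_sub_one_of_pos (inv_pos.2 htpos)
      rwa [Real.log_inv] at h
    have hlog0 : 0 ≤ -Real.log t := by have := Real.log_nonpos ht h1; linarith
    have htα : t ^ α ≤ t :=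
      calc t ^ α ≤ t ^ (1 : ℝ) := Real.rpow_le_rpow_of_exponent_ge htpos h1 hα1
        _ = t := Real.rpow_one t
    have hsplit : t ^ (2 : ℝ) = t ^ α * t ^ (2 - α) := by
      rw [← Real.rpow_add htpos]; congr 1; ring
    have h2 : t ^ α * (1 - t ^ (2 - α)) ≤ 2 - α :=
      calc t ^ α * (1 - t ^ (2 - α)) ≤ t ^ α * (-((2 - α) * Real.log t)) :=
            mul_le_mul_of_nonneg_left hlog (Real.rpow_nonneg ht α)
        _ = (2 - α) * (t ^ α * (-Real.log t)) := by ring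
        _ ≤ (2 - α) * (t * (t⁻¹ - 1)) := by
            apply mul_le_mul_of_nonneg_left _ (by linarith)
            calc t ^ α * (-Real.log t) ≤ t * (-Real.log t) := mul_le_mul_of_nonneg_right htα hlog0
              _ ≤ t * (t⁻¹ - 1) := mul_le_mul_of_nonneg_left hneglog ht
        _ = (2 - α) * (1 - t) := by rw [mul_sub, mul_inv_cancel₀ htpos.ne', mul_one]
        _ ≤ 2 - α := by nlinarith
    rw [hsplit]
    nlinarith [h2]

/-- Termwise: `|k|^α ≤ |k|² + (2 - α)` for the plane waves of a torus of side `L > 0`, `1 ≤ α ≤ 2`. [folklore] -/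
theorem fracDispersion_le_two_add (hL : 0 < L) {α : ℝ} (hα1 : 1 ≤ α) (hα2 : α ≤ 2) (p : Fin 3 → ℤ) :
    fracDispersion α L p ≤ fracDispersion 2 L p + ENNReal.ofReal (2 - α) := by
  unfold fracDispersion
  have ht : 0 ≤ 2 * Real.pi / L * Real.sqrt (∑ k : Fin 3, ((p k : ℤ) : ℝ) ^ 2) := by positivity
  rw [← ENNReal.ofReal_add (Real.rpow_nonneg ht _) (by linarith)]
  exact ENNReal.ofReal_le_ofReal (rpow_le_rpow_two_add ht hα1 hα2)

/-- **(H1) The dial comparison with its endpoint**: `E_α[Ψ] ≤ ⟨Ψ, HΨ⟩ + (2 - α) N` for `1 ≤ α ≤ 2` and every periodic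
trial state on a torus of side `L > 0` (`|k|^α ≤ |k|² + (2-α)` termwise and `∑_p n_Ψ(p) = N`). [folklore] -/
theorem fracPeriodicEnergy_le_periodicEnergy_add {α : ℝ} (hα1 : 1 ≤ α) (hα2 : α ≤ 2) (hL : 0 < L)
    (v : ℝ → ℝ≥0∞) (Ψ : PeriodicTrialState N L) :
    fracPeriodicEnergy α v N L Ψ.ψ ≤ periodicEnergy v Ψ + ENNReal.ofReal (2 - α) * N := by
  rw [← fracPeriodicEnergy_two hL v Ψ, fracPeriodicEnergy_apply, fracPeriodicEnergy_apply, add_right_comm]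
  gcongr ?_ + _
  calc ∑' p, fracDispersion α L p * cellOccupation N L (planeWaveMode L p) Ψ.ψ
      ≤ ∑' p, (fracDispersion 2 L p + ENNReal.ofReal (2 - α)) * cellOccupation N L (planeWaveMode L p) Ψ.ψ :=
        ENNReal.tsum_le_tsum fun p => by gcongr; exact fracDispersion_le_two_add hL hα1 hα2 p
    _ = (∑' p, fracDispersion 2 L p * cellOccupation N L (planeWaveMode L p) Ψ.ψ) +
          ENNReal.ofReal (2 - α) * ∑' p, cellOccupation N L (planeWaveMode L p) Ψ.ψ := by
        simp only [add_mul]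
        rw [ENNReal.tsum_add, ENNReal.tsum_mul_left]
    _ = _ := by rw [Ψ.tsum_cellOccupation_planeWaveMode hL]

/-! ### Truncated potentials: monotonicity and boundedness -/

/-- The fractional energy is monotone in the pair potential. [folklore] -/
theorem fracPeriodicEnergy_mono (α : ℝ) {v w : ℝ → ℝ≥0∞} (h : ∀ r, v r ≤ w r) (N : ℕ) (L : ℝ) (ψ : Config N → ℂ) :
    fracPeriodicEnergy α v N L ψ ≤ fracPeriodicEnergy α w N L ψ := by
  rw [fracPeriodicEnergy_apply, fracPeriodicEnergy_apply]
  gcongr _ + ?_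
  refine lintegral_mono fun X => mul_le_mul_left ?_ _
  unfold periodicInteraction periodizedPotential
  exact Finset.sum_le_sum fun i _ => Finset.sum_le_sum fun j _ => ENNReal.tsum_le_tsum fun _ => h _

/-- `E_α(min(v,n)) ≤ E_α(v)`. [folklore] -/
theorem fracPeriodicGroundStateEnergy_truncPotential_le (α : ℝ) (v : ℝ → ℝ≥0∞) (n N : ℕ) (L : ℝ) :
    fracPeriodicGroundStateEnergy α (truncPotential v n) N L ≤ fracPeriodicGroundStateEnergy α v N L :=
  iInf_mono fun Ψ => fracPeriodicEnergy_mono α (truncPotential_le v n) N L Ψ.ψ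

/-- **The truncations of an admissible potential have bounded periodic interaction**: for `v` of finite range and
`L > 0`, `∑_{i<j} min(v,n)^per(xᵢ - xⱼ) ≤ M` on all configurations (finitely many images contribute). [folklore] -/
theorem exists_bound_periodicInteraction_truncPotential {v : ℝ → ℝ≥0∞} (hv : IsRepulsiveFiniteRange v) (hL : 0 < L)
    (n : ℕ) : ∃ M : ℝ≥0, ∀ X : Config N, periodicInteraction (truncPotential v n) L X ≤ M := by
  have hfr : IsRepulsiveFiniteRange (truncPotential v n) := by
    refine ⟨measurable_truncPotential hv.1 n, ?_⟩
    obtain ⟨R₀, hR₀⟩ := hv.2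
    exact ⟨R₀, fun r hr => truncPotential_eq_zero (hR₀ r hr) n⟩
  obtain ⟨C, hC⟩ := Cruxes.HardCoreExtension.ThirdLawCurrentFloor.exists_periodizedPotential_le hfr
    ⟨n, ENNReal.natCast_ne_top n, fun r => truncPotential_le_nat v n r⟩ hL
  refine ⟨(N * N : ℕ) * C, fun X => ?_⟩
  have h := periodicInteraction_le_of_bound (C := (C : ℝ≥0∞)) hC X
  push_cast at h ⊢
  exact h

/-! ### (H2) Energy continuity from the maximal-form bound -/

/-- `E^per(v) ≤ supₙ E^per(min(v,n))` from the maximal-form bound at `(v, N, L)` and the tree's compactness half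
`exists_limitProfile`. [cite: ReedSimonIV1978, Thm. XIII.64] -/
theorem periodicGroundStateEnergy_le_iSup_trunc {v : ℝ → ℝ≥0∞} (hv : Measurable v) (hL : 0 < L)
    (hcore : ∀ η : Lp ℂ 2 (volume : Measure (UnitAddTorus (Fin N × Fin 3))), ‖η‖ = 1 →
      (∀ (σ : Equiv.Perm (Fin N)) (n : Fin N × Fin 3 → ℤ),
        ⟪(mFourierLp 2 (fun p : Fin N × Fin 3 => n (σ p.1, p.2)) : Lp ℂ 2 (volume : Measure (UnitAddTorus (Fin N × Fin 3)))), η⟫_ℂ =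
          ⟪(mFourierLp 2 n : Lp ℂ 2 (volume : Measure (UnitAddTorus (Fin N × Fin 3)))), η⟫_ℂ) →
      periodicGroundStateEnergy v N L ≤
        ∑' n : Fin N × Fin 3 → ℤ, ENNReal.ofReal (∑ p, (2 * Real.pi * (n p : ℝ) / L) ^ 2) *
            (‖⟪(mFourierLp 2 n : Lp ℂ 2 (volume : Measure (UnitAddTorus (Fin N × Fin 3)))), η⟫_ℂ‖₊ : ℝ≥0∞) ^ 2 +
          ∫⁻ t, periodicInteraction v L (fromUnitTorusN L t) * (‖(η : UnitAddTorus (Fin N × Fin 3) → ℂ) t‖₊ : ℝ≥0∞) ^ 2) :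
    periodicGroundStateEnergy v N L ≤ ⨆ n : ℕ, periodicGroundStateEnergy (truncPotential v n) N L := by
  by_cases hE : (⨆ n : ℕ, periodicGroundStateEnergy (truncPotential v n) N L) = ⊤
  · rw [hE]; exact le_top
  obtain ⟨η, hη1, hηsymm, hηE⟩ := exists_limitProfile hv hL hE
  exact (hcore η hη1 hηsymm).trans hηE

/-- If the periodic ground-state energy is infinite, every periodic trial state has infinite interaction energy, so
every fractional ground-state energy is infinite as well. [folklore] -/
theorem fracPeriodicGroundStateEnergy_eq_top (v : ℝ → ℝ≥0∞) (hE : periodicGroundStateEnergy v N L = ⊤) (α : ℝ) :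
    fracPeriodicGroundStateEnergy α v N L = ⊤ := by
  refine iInf_eq_top.2 fun Ψ => ?_
  have hEΨ : periodicEnergy v Ψ = ⊤ := top_unique (hE ▸ periodicGroundStateEnergy_le v Ψ)
  have hkin : ∫⁻ X in cellN N L, kineticDensity Ψ.ψ X ≠ ⊤ := by
    have h : periodicEnergy 0 Ψ < ⊤ :=
      lintegral_energy_lt_top measurable_zeroProfile (lintegral_periodicInteraction_zero_ne_top N L) Ψ.contDiff
    rw [periodicEnergy_zero_eq] at h
    exact h.ne
  have hsum : periodicEnergy v Ψ = (∫⁻ X in cellN N L, kineticDensity Ψ.ψ X) +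
      ∫⁻ X in cellN N L, periodicInteraction v L X * (‖Ψ.ψ X‖₊ : ℝ≥0∞) ^ 2 :=
    lintegral_add_left (measurable_kineticDensity_any Ψ.ψ) _
  rw [hsum] at hEΨ
  rw [fracPeriodicEnergy_apply, (ENNReal.add_eq_top.1 hEΨ).resolve_left hkin, add_top]

/-- **(H2) Energy continuity at the endpoint from the maximal-form bound.** For an admissible `v`, `L > 0` and the
maximal-form bound at `(v, N, L)`: `∀ ε > 0 ∃ α₁ < 2 ∀ α ∈ [α₁, 2), E^per(v) ≤ E_α(v) + ε` — a truncation height `n`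
with `E^per(v) ≤ E^per(min(v,n)) + ε/2` (`periodicGroundStateEnergy_le_iSup_trunc`), part II for the bounded truncation,
and `E_α(min(v,n)) ≤ E_α(v)`. [folklore] -/
theorem energyContinuity_of_maxFormBound {v : ℝ → ℝ≥0∞} (hv : IsRepulsiveFiniteRange v) (hL : 0 < L)
    (hcore : ∀ η : Lp ℂ 2 (volume : Measure (UnitAddTorus (Fin N × Fin 3))), ‖η‖ = 1 →
      (∀ (σ : Equiv.Perm (Fin N)) (n : Fin N × Fin 3 → ℤ),
        ⟪(mFourierLp 2 (fun p : Fin N × Fin 3 => n (σ p.1, p.2)) : Lp ℂ 2 (volume : Measure (UnitAddTorus (Fin N × Fin 3)))), η⟫_ℂ =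
          ⟪(mFourierLp 2 n : Lp ℂ 2 (volume : Measure (UnitAddTorus (Fin N × Fin 3)))), η⟫_ℂ) →
      periodicGroundStateEnergy v N L ≤
        ∑' n : Fin N × Fin 3 → ℤ, ENNReal.ofReal (∑ p, (2 * Real.pi * (n p : ℝ) / L) ^ 2) *
            (‖⟪(mFourierLp 2 n : Lp ℂ 2 (volume : Measure (UnitAddTorus (Fin N × Fin 3)))), η⟫_ℂ‖₊ : ℝ≥0∞) ^ 2 +
          ∫⁻ t, periodicInteraction v L (fromUnitTorusN L t) * (‖(η : UnitAddTorus (Fin N × Fin 3) → ℂ) t‖₊ : ℝ≥0∞) ^ 2)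
    {ε : ℝ≥0∞} (hε : 0 < ε) :
    ∃ α₁ : ℝ, α₁ < 2 ∧ ∀ α : ℝ, α₁ ≤ α → α < 2 →
      periodicGroundStateEnergy v N L ≤ fracPeriodicGroundStateEnergy α v N L + ε := by
  set E₂ := periodicGroundStateEnergy v N L with hE₂
  rcases eq_or_ne E₂ ⊤ with hEtop | hEfin
  · refine ⟨1, by norm_num, fun α _ _ => ?_⟩
    rw [fracPeriodicGroundStateEnergy_eq_top v hEtop α, top_add]
    exact le_top
  rcases eq_or_ne ε ⊤ with hεtop | hεtop
  · exact ⟨1, by norm_num, fun α _ _ => by rw [hεtop, add_top]; exact le_top⟩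
  have hε2 : 0 < ε / 2 := ENNReal.div_pos hε.ne' (by norm_num)
  -- a truncation height with `E₂ ≤ E^per(min(v,n)) + ε/2`
  have hsup := periodicGroundStateEnergy_le_iSup_trunc hv.1 hL hcore
  obtain ⟨n, hn⟩ : ∃ n : ℕ, E₂ ≤ periodicGroundStateEnergy (truncPotential v n) N L + ε / 2 := by
    by_cases hsmall : E₂ ≤ ε / 2
    · exact ⟨0, hsmall.trans le_add_self⟩
    · have hE0 : E₂ ≠ 0 := fun h0 => hsmall (h0 ▸ bot_le)
      have hlt : E₂ - ε / 2 < E₂ := ENNReal.sub_lt_self hEfin hE0 hε2.ne'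
      obtain ⟨n, hn⟩ := lt_iSup_iff.1 (hlt.trans_le hsup)
      exact ⟨n, tsub_le_iff_right.1 hn.le⟩
  -- energy continuity for the bounded truncation
  obtain ⟨M, hM⟩ := exists_bound_periodicInteraction_truncPotential (N := N) hv hL n
  obtain ⟨α₁, hα₁, hcont⟩ := energyContinuity_of_bounded (N := N) hL (measurable_truncPotential hv.1 n) hM hε2
  refine ⟨α₁, hα₁, fun α h1 h2 => ?_⟩
  calc E₂ ≤ periodicGroundStateEnergy (truncPotential v n) N L + ε / 2 := hn
    _ ≤ (fracPeriodicGroundStateEnergy α (truncPotential v n) N L + ε / 2) + ε / 2 := by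
        gcongr
        exact hcont α h1 h2
    _ ≤ (fracPeriodicGroundStateEnergy α v N L + ε / 2) + ε / 2 := by
        gcongr
        exact fracPeriodicGroundStateEnergy_truncPotential_le α v n N L
    _ = fracPeriodicGroundStateEnergy α v N L + ε := by rw [add_assoc, ENNReal.add_halves]

/-! ### The glue: near-minimisers of `E_2` are near-minimisers of `E_α` -/

/-- **The endpoint transfer from energy continuity** (the item's glue, no uniqueness): given (H2) at `(v, N, L)` and the
dial hypothesis with slack `δ` on the window `(α₀, 2)`, every `δ/3`-near-minimiser `Ψ` of `periodicEnergy` is, for a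
suitable `α` in the window (`α ≥ 1`, `(2-α)N ≤ δ/3`, `E^per ≤ E_α + δ/3`), a `δ`-near-minimiser of `E_α` by (H1), hence
has condensate occupation `≥ cN`. [folklore] -/
theorem endpointTransfer_of_energyContinuity (hL : 0 < L) (v : ℝ → ℝ≥0∞)
    (hcont : ∀ ε : ℝ≥0∞, 0 < ε → ∃ α₁ : ℝ, α₁ < 2 ∧ ∀ α : ℝ, α₁ ≤ α → α < 2 →
      periodicGroundStateEnergy v N L ≤ fracPeriodicGroundStateEnergy α v N L + ε)
    {c α₀ : ℝ} (hα₀ : α₀ < 2) {δ : ℝ≥0∞} (hδ : 0 < δ)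
    (hyp : ∀ α : ℝ, α₀ < α → α < 2 → ∀ Ψ : PeriodicTrialState N L,
      fracPeriodicEnergy α v N L Ψ.ψ ≤ fracPeriodicGroundStateEnergy α v N L + δ →
        ENNReal.ofReal (c * N) ≤ condensateOccupation N L Ψ.ψ) :
    ∃ δ' : ℝ≥0∞, 0 < δ' ∧ ∀ Ψ : PeriodicTrialState N L,
      periodicEnergy v Ψ ≤ periodicGroundStateEnergy v N L + δ' →
        ENNReal.ofReal (c * N) ≤ condensateOccupation N L Ψ.ψ := by
  -- infinite slack: every state is a near-minimiser of every `E_α`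
  rcases eq_or_ne δ ⊤ with hδtop | hδtop
  · refine ⟨1, zero_lt_one, fun Ψ _ => hyp ((α₀ + 2) / 2) (by linarith) (by linarith) Ψ ?_⟩
    rw [hδtop, add_top]
    exact le_top
  -- finite slack: `δ₃ = δ/3`
  set δ₃ : ℝ≥0∞ := δ / 3 with hδ₃
  have hδ₃pos : 0 < δ₃ := ENNReal.div_pos hδ.ne' (by norm_num)
  have hδ₃fin : δ₃ ≠ ⊤ := ENNReal.div_ne_top hδtop (by norm_num)
  obtain ⟨α₁, hα₁, hH2⟩ := hcont δ₃ hδ₃pos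
  -- the exponent: above `α₀`, `α₁`, `1`, and so close to `2` that `(2 - α) N ≤ δ₃`
  set t : ℝ := δ₃.toReal / (N + 1) with ht
  have htpos : 0 < t := div_pos (ENNReal.toReal_pos hδ₃pos.ne' hδ₃fin) (by positivity)
  set α : ℝ := max (max (max ((α₀ + 2) / 2) α₁) 1) (2 - t) with hα
  have hα_gt : α₀ < α := lt_of_lt_of_le (by linarith) ((le_max_left _ _).trans ((le_max_left _ _).trans (le_max_left _ _)))
  have hα_one : 1 ≤ α := (le_max_right _ _).trans (le_max_left _ _)
  have hα_α₁ : α₁ ≤ α := (le_max_right _ _).trans ((le_max_left _ _).trans (le_max_left _ _))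
  have hα_t : 2 - t ≤ α := le_max_right _ _
  have hα_lt : α < 2 := max_lt (max_lt (max_lt (by linarith) hα₁) (by norm_num)) (by linarith)
  have hcomp : ENNReal.ofReal (2 - α) * N ≤ δ₃ := by
    rw [← ENNReal.ofReal_natCast, ← ENNReal.ofReal_mul (by linarith), ← ENNReal.ofReal_toReal hδ₃fin]
    refine ENNReal.ofReal_le_ofReal ?_
    have hN : (0 : ℝ) ≤ N := Nat.cast_nonneg N
    have h1 : (2 - α) * N ≤ t * N := mul_le_mul_of_nonneg_right (by linarith) hN
    have h2 : t * N ≤ δ₃.toReal := by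
      rw [ht, div_mul_eq_mul_div, div_le_iff₀ (by positivity)]
      nlinarith [ENNReal.toReal_nonneg (a := δ₃)]
    linarith
  refine ⟨δ₃, hδ₃pos, fun Ψ hΨ => hyp α hα_gt hα_lt Ψ ?_⟩
  calc fracPeriodicEnergy α v N L Ψ.ψ ≤ periodicEnergy v Ψ + ENNReal.ofReal (2 - α) * N :=
        fracPeriodicEnergy_le_periodicEnergy_add hα_one hα_lt.le hL v Ψ
    _ ≤ (periodicGroundStateEnergy v N L + δ₃) + δ₃ := add_le_add hΨ hcomp
    _ ≤ ((fracPeriodicGroundStateEnergy α v N L + δ₃) + δ₃) + δ₃ := by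
        gcongr
        exact hH2 α hα_α₁ hα_lt
    _ = fracPeriodicGroundStateEnergy α v N L + δ := by
        rw [hδ₃, add_assoc, add_assoc, ← add_assoc (δ / 3), ENNReal.add_thirds]

/-! ### The endpoint transfer: from the maximal-form bound, and unconditionally for integrable interactions -/

/-- **`EndpointTransfer` at `(v, N, L)` from the maximal-form bound at `(v, N, L)`.** [folklore] -/
theorem endpointTransfer_at_of_maxFormBound {v : ℝ → ℝ≥0∞} (hv : IsRepulsiveFiniteRange v) (hL : 0 < L)
    (hcore : ∀ η : Lp ℂ 2 (volume : Measure (UnitAddTorus (Fin N × Fin 3))), ‖η‖ = 1 →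
      (∀ (σ : Equiv.Perm (Fin N)) (n : Fin N × Fin 3 → ℤ),
        ⟪(mFourierLp 2 (fun p : Fin N × Fin 3 => n (σ p.1, p.2)) : Lp ℂ 2 (volume : Measure (UnitAddTorus (Fin N × Fin 3)))), η⟫_ℂ =
          ⟪(mFourierLp 2 n : Lp ℂ 2 (volume : Measure (UnitAddTorus (Fin N × Fin 3)))), η⟫_ℂ) →
      periodicGroundStateEnergy v N L ≤
        ∑' n : Fin N × Fin 3 → ℤ, ENNReal.ofReal (∑ p, (2 * Real.pi * (n p : ℝ) / L) ^ 2) *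
            (‖⟪(mFourierLp 2 n : Lp ℂ 2 (volume : Measure (UnitAddTorus (Fin N × Fin 3)))), η⟫_ℂ‖₊ : ℝ≥0∞) ^ 2 +
          ∫⁻ t, periodicInteraction v L (fromUnitTorusN L t) * (‖(η : UnitAddTorus (Fin N × Fin 3) → ℂ) t‖₊ : ℝ≥0∞) ^ 2)
    {c α₀ : ℝ} (hα₀ : α₀ < 2) {δ : ℝ≥0∞} (hδ : 0 < δ)
    (hyp : ∀ α : ℝ, α₀ < α → α < 2 → ∀ Ψ : PeriodicTrialState N L,
      fracPeriodicEnergy α v N L Ψ.ψ ≤ fracPeriodicGroundStateEnergy α v N L + δ →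
        ENNReal.ofReal (c * N) ≤ condensateOccupation N L Ψ.ψ) :
    ∃ δ' : ℝ≥0∞, 0 < δ' ∧ ∀ Ψ : PeriodicTrialState N L,
      periodicEnergy v Ψ ≤ periodicGroundStateEnergy v N L + δ' →
        ENNReal.ofReal (c * N) ≤ condensateOccupation N L Ψ.ψ :=
  endpointTransfer_of_energyContinuity hL v (fun _ hε => energyContinuity_of_maxFormBound hv hL hcore hε) hα₀ hδ hyp

/-- **`MaxFormBound → EndpointTransfer`.** The route's support item is a theorem modulo the maximal-form bound — the
hypothesis `hcore`, VERBATIM the hypothesis of `…UvThomsonForceWave.truncationLimit_of_maxFormBound` (the registered stub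
`stub_maxFormBound` of stmt-AtomisticToContinuum-12057): for every admissible `v`, `N`, `L > 0` and every unit
Bose-symmetric `η ∈ L²((ℝ/ℤ)^{3N})`, the periodic `C¹` Bose core energy infimum is at most the maximal-form energy of
`η`. [folklore] -/
theorem endpointTransfer_of_maxFormBound
    (hcore : ∀ v : ℝ → ℝ≥0∞, IsRepulsiveFiniteRange v → ∀ (N : ℕ) (L : ℝ), 0 < L →
      ∀ η : Lp ℂ 2 (volume : Measure (UnitAddTorus (Fin N × Fin 3))), ‖η‖ = 1 →
        (∀ (σ : Equiv.Perm (Fin N)) (n : Fin N × Fin 3 → ℤ),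
          ⟪(mFourierLp 2 (fun p : Fin N × Fin 3 => n (σ p.1, p.2)) :
              Lp ℂ 2 (volume : Measure (UnitAddTorus (Fin N × Fin 3)))), η⟫_ℂ =
            ⟪(mFourierLp 2 n : Lp ℂ 2 (volume : Measure (UnitAddTorus (Fin N × Fin 3)))), η⟫_ℂ) →
        periodicGroundStateEnergy v N L ≤
          ∑' n : Fin N × Fin 3 → ℤ, ENNReal.ofReal (∑ p, (2 * Real.pi * (n p : ℝ) / L) ^ 2) *
              (‖⟪(mFourierLp 2 n : Lp ℂ 2 (volume : Measure (UnitAddTorus (Fin N × Fin 3)))), η⟫_ℂ‖₊ :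
                ℝ≥0∞) ^ 2 +
            ∫⁻ t, periodicInteraction v L (fromUnitTorusN L t) *
              (‖(η : UnitAddTorus (Fin N × Fin 3) → ℂ) t‖₊ : ℝ≥0∞) ^ 2) :
    Summit.AtomisticToContinuum.BoseEinsteinCondensation.Theses.BECDispersionLadder.EndpointTransfer := by
  intro v hv N L hL c α₀ _ hα₀ δ hδ hyp
  exact endpointTransfer_at_of_maxFormBound hv hL (hcore v hv N L hL) hα₀ hδ hyp

/-- **`EndpointTransfer` unconditionally for integrable interactions.** For every admissible `v` with
`∫_{[0,L)^{3N}} W < ∞` (no hard core on the cell), the conclusion of the route's item holds at `(v, N, L)`: the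
maximal-form bound is the tree's `BoseGas.periodicGroundStateEnergy_le_maxForm` (Simon's form-core theorem in the Bose
sector). [cite: ReedSimonIV1978, Thm. XIII.64] -/
theorem endpointTransfer_of_integrable (v : ℝ → ℝ≥0∞) (hv : IsRepulsiveFiniteRange v) (N : ℕ) (L : ℝ) (hL : 0 < L)
    (hWint : ∫⁻ X in cellN N L, periodicInteraction v L X ≠ ⊤) (c α₀ : ℝ) (hα₀ : α₀ < 2) (δ : ℝ≥0∞) (hδ : 0 < δ)
    (hyp : ∀ α : ℝ, α₀ < α → α < 2 → ∀ Ψ : PeriodicTrialState N L,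
      fracPeriodicEnergy α v N L Ψ.ψ ≤ fracPeriodicGroundStateEnergy α v N L + δ →
        ENNReal.ofReal (c * N) ≤ condensateOccupation N L Ψ.ψ) :
    ∃ δ' : ℝ≥0∞, 0 < δ' ∧ ∀ Ψ : PeriodicTrialState N L,
      periodicEnergy v Ψ ≤ periodicGroundStateEnergy v N L + δ' →
        ENNReal.ofReal (c * N) ≤ condensateOccupation N L Ψ.ψ :=
  endpointTransfer_at_of_maxFormBound hv hL
    (fun η hη1 hsymm => periodicGroundStateEnergy_le_maxForm hL hv.1 hWint η hη1 hsymm) hα₀ hδ hyp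

/-- **`EndpointTransfer` unconditionally for bounded potentials** (`v ≤ M < ⊤`, finite range): the periodic
interaction is then bounded, hence integrable on the cell. [folklore] -/
theorem endpointTransfer_of_bounded (v : ℝ → ℝ≥0∞) (hv : IsRepulsiveFiniteRange v)
    (hbdd : ∃ M : ℝ≥0∞, M ≠ ⊤ ∧ ∀ r, v r ≤ M) (N : ℕ) (L : ℝ) (hL : 0 < L)
    (c α₀ : ℝ) (hα₀ : α₀ < 2) (δ : ℝ≥0∞) (hδ : 0 < δ)
    (hyp : ∀ α : ℝ, α₀ < α → α < 2 → ∀ Ψ : PeriodicTrialState N L,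
      fracPeriodicEnergy α v N L Ψ.ψ ≤ fracPeriodicGroundStateEnergy α v N L + δ →
        ENNReal.ofReal (c * N) ≤ condensateOccupation N L Ψ.ψ) :
    ∃ δ' : ℝ≥0∞, 0 < δ' ∧ ∀ Ψ : PeriodicTrialState N L,
      periodicEnergy v Ψ ≤ periodicGroundStateEnergy v N L + δ' →
        ENNReal.ofReal (c * N) ≤ condensateOccupation N L Ψ.ψ := by
  obtain ⟨C, hC⟩ := Cruxes.HardCoreExtension.ThirdLawCurrentFloor.exists_periodizedPotential_le hv hbdd hL
  refine endpointTransfer_of_integrable v hv N L hL ?_ c α₀ hα₀ δ hδ hyp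
  refine ne_top_of_le_ne_top ?_ (lintegral_mono fun X => periodicInteraction_le_of_bound (C := (C : ℝ≥0∞)) hC X)
  rw [setLIntegral_const, volume_cellN]
  exact ENNReal.mul_ne_top (ENNReal.mul_ne_top (ENNReal.natCast_ne_top _) ENNReal.coe_ne_top)
    (ENNReal.pow_ne_top (ENNReal.pow_ne_top ENNReal.ofReal_ne_top))

end EndpointTransfer

end Summit.AtomisticToContinuum.BoseEinsteinCondensation.Theorems

end
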